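import Summits.KontsevichZagierPeriods.KontsevichZagierPeriods.Theorems.PlanarAreas.Negative.Core
import Literature.NumberTheory.Transcendental.KZCalculusProofs
import Literature.NumberTheory.Transcendental.KZIntervalPeriodProofs

/-!
# `PlanarAreas` (stmt-KontsevichZagierPeriods-4990), line `green-native-bands`: load-bearing
# hypotheses of the engine stub `stub_bandNewtonLeibniz` (negative lemmas)

Refuter unit `drefute-stmt-KontsevichZagierPeriods-4990` on the lead's skeleton v2
(`Cruxes/PlanarAreas/Lines/green-native-bands.lean`, stubs registered 2026-08-16T02:18Z).
The engine stub (Newton–Leibniz down a closed band `{a₀ ≤ x ≤ a₁, α x ≤ y ≤ β x}` off a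
`ℚ`-semialgebraic null exceptional set `Z`, primitive `F` continuous on each closed fibre) is TRUE
on paper; here we record, as kernel-checked facts, which of its hypotheses are LOAD-BEARING: each of
the three statements below is the stub verbatim with ONE hypothesis deleted, and each is false by
soundness of the calculus (`KZ.Equivalent.value_eq_holds`):

* `not_bandNLWithoutNullZ`   — delete `volume Z = 0` (witness `Z = univ`, `F = y`, integrand `0`);
* `not_bandNLWithoutFibreContinuity` — delete the fibrewise continuity of `F` on the closed
  fibre (witness `F = 𝟙{y ≥ 1}`, a jump at the top end point, integrand `0`, `Z = ∅`);
* `not_bandNLWithoutLE` — delete `α ≤ β` on the base (witness `α = 1`, `β = 0`, `F = y`, the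
  empty band; the reading fixed in `KZCalculus.lean`'s design notes).

By contrast (paper remarks, no Lean content): `a₀ < a₁` is unnecessary (for `a₁ ≤ a₀` everything
is null or empty), and `IsSemialgebraic ℚ Z` / the semialgebraicity of `α, β` are implied by the
remaining data (the bad set is definable; `α, β` are definable from `r.domain`).
-/

noncomputable section

open Set MeasureTheory MvPolynomial Filter Topology
open Literature.NumberTheory.Transcendental Literature.ModelTheory.ExponentialFields

namespace Summit.KontsevichZagierPeriods.PlanarAreas.Negative.GreenBands

/-! ## Test data: the base `(0,1) ⊂ ℝ¹`, the closed unit square as a band, integrand `0` -/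

/-- The base `(0,1) ⊂ ℝ¹` in the stub's literal shape (rational end points cast to `ℝ`). -/
def baseSet : Set (Fin 1 → ℝ) := {z : Fin 1 → ℝ | z 0 ∈ Set.Ioo ((0 : ℚ) : ℝ) ((1 : ℚ) : ℝ)}

/-- `baseSet` is the open unit interval of `ℝ¹`. -/
theorem baseSet_eq : baseSet = {x : Fin 1 → ℝ | 0 < x 0 ∧ x 0 < 1} := by
  ext z; simp [baseSet]

/-- `baseSet` as a product of intervals. -/
theorem baseSet_eq_pi : baseSet = Set.pi univ fun _ : Fin 1 => Ioo (0 : ℝ) 1 := by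
  ext z
  simp [baseSet, Set.mem_pi, Fin.forall_fin_one]

/-- `baseSet` is `ℚ`-semialgebraic. -/
theorem isSemialgebraic_baseSet : IsSemialgebraic ℚ baseSet := by
  rw [baseSet_eq]; exact isSemialgebraic_unitInterval_fin_one

/-- `baseSet` is measurable. -/
theorem measurableSet_baseSet : MeasurableSet baseSet := by
  rw [baseSet_eq_pi]; exact MeasurableSet.univ_pi fun _ => measurableSet_Ioo

/-- `baseSet` has length `1`. -/
theorem volume_baseSet : volume baseSet = 1 := by
  rw [baseSet_eq_pi]
  have := Real.volume_pi_Ioo (a := fun _ : Fin 1 => (0 : ℝ)) (b := fun _ => 1)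
  simpa using this

/-- A 1-dimensional representation on `(0,1)` whose integrand is the constant `c` on the domain
represents `c`. -/
theorem value_eq_of_const {r' : KZ.IntegralRep 1} (hd : r'.domain = baseSet) (c : ℝ)
    (hi : ∀ z ∈ r'.domain, r'.integrand z = c) : r'.value = c := by
  unfold KZ.IntegralRep.value
  rw [hd] at hi ⊢
  rw [setIntegral_congr_fun measurableSet_baseSet hi, setIntegral_const, smul_eq_mul,
    measureReal_def, volume_baseSet, ENNReal.toReal_one, one_mul]

/-- `[[0,1]², 0]`: the closed unit square with integrand `0`. -/
def zeroSquare : KZ.IntegralRep 2 where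
  domain := closedSquareSet
  integrand := fun _ => 0
  isSemialgebraic_domain := isSemialgebraic_closedSquareSet
  isSemialgebraicFunOn_integrand := by
    simpa using isSemialgebraicFunOn_natCast isSemialgebraic_closedSquareSet 0
  integrableOn := integrableOn_zero

/-- The domain of `zeroSquare`. -/
@[simp] theorem zeroSquare_domain : zeroSquare.domain = closedSquareSet := rfl
/-- The integrand of `zeroSquare`. -/
@[simp] theorem zeroSquare_integrand : zeroSquare.integrand = fun _ => 0 := rfl

/-- `zeroSquare` represents `0`. -/
theorem value_zeroSquare : zeroSquare.value = 0 := by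
  simp [KZ.IntegralRep.value]

/-- The closed unit square is the band over `[0,1]` between the constants `0 ≤ 1`, in the stub's
literal shape. -/
theorem closedSquareSet_eq_band : closedSquareSet =
    {p : Fin 2 → ℝ | p 0 ∈ Set.Icc ((0 : ℚ) : ℝ) ((1 : ℚ) : ℝ) ∧ (0 : ℝ) ≤ p 1 ∧ p 1 ≤ 1} := by
  ext p
  simp only [closedSquareSet, Rat.cast_zero, Rat.cast_one, mem_setOf_eq, mem_Icc]
  tauto

/-- The coordinate `y` is `ℚ`-semialgebraic on the closed square. -/
theorem isSemialgebraicFunOn_snd : IsSemialgebraicFunOn ℚ closedSquareSet (fun p : Fin 2 → ℝ => p 1) :=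
  isSemialgebraicFunOn_apply isSemialgebraic_closedSquareSet 1

/-! ## (1) `volume Z = 0` is load-bearing -/

/-- `stub_bandNewtonLeibniz` with the hypothesis `volume Z = 0` DELETED (everything else verbatim). -/
def BandNLWithoutNullZ : Prop := ∀ (a₀ a₁ : ℚ) (α β : ℝ → ℝ) (F : (Fin 2 → ℝ) → ℝ)
    (Z : Set (Fin 2 → ℝ)) (r : KZ.IntegralRep 2), a₀ < a₁ →
    IsSemialgebraicFunOn ℚ {z : Fin 1 → ℝ | z 0 ∈ Set.Ioo (a₀ : ℝ) a₁} (fun z => α (z 0)) →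
    IsSemialgebraicFunOn ℚ {z : Fin 1 → ℝ | z 0 ∈ Set.Ioo (a₀ : ℝ) a₁} (fun z => β (z 0)) →
    (∀ t ∈ Set.Ioo (a₀ : ℝ) a₁, α t ≤ β t) →
    r.domain = {p : Fin 2 → ℝ | p 0 ∈ Set.Icc (a₀ : ℝ) a₁ ∧ α (p 0) ≤ p 1 ∧ p 1 ≤ β (p 0)} →
    IsSemialgebraicFunOn ℚ r.domain F →
    (∀ t ∈ Set.Ioo (a₀ : ℝ) a₁, ContinuousOn (fun s : ℝ => F ![t, s]) (Set.Icc (α t) (β t))) →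
    IsSemialgebraic ℚ Z →
    (∀ p ∈ r.domain, p 0 ∈ Set.Ioo (a₀ : ℝ) a₁ → α (p 0) < p 1 → p 1 < β (p 0) → p ∉ Z →
      HasDerivAt (fun s : ℝ => F ![p 0, s]) (r.integrand p) (p 1)) →
    ∃ r' : KZ.IntegralRep 1, r'.domain = {z : Fin 1 → ℝ | z 0 ∈ Set.Ioo (a₀ : ℝ) a₁} ∧
      (∀ z ∈ r'.domain, r'.integrand z = F ![z 0, β (z 0)] - F ![z 0, α (z 0)]) ∧
      KZ.of r - KZ.of r' ∈ KZ.relations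

/-- **`volume Z = 0` is load-bearing in `stub_bandNewtonLeibniz`.** Without it take `Z = univ`
(so the derivative hypothesis is void), the closed unit square with integrand `0`, and the
primitive `F = y`: the stub would produce `[(0,1), 1]` equivalent to `[[0,1]², 0]`, i.e. `1 = 0` by
soundness. -/
theorem not_bandNLWithoutNullZ : ¬ BandNLWithoutNullZ := by
  intro h
  have hb : IsSemialgebraic ℚ {z : Fin 1 → ℝ | z 0 ∈ Set.Ioo ((0 : ℚ) : ℝ) ((1 : ℚ) : ℝ)} :=
    isSemialgebraic_baseSet
  have hα : IsSemialgebraicFunOn ℚ {z : Fin 1 → ℝ | z 0 ∈ Set.Ioo ((0 : ℚ) : ℝ) ((1 : ℚ) : ℝ)}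
      (fun z => (fun _ : ℝ => (0 : ℝ)) (z 0)) := by
    simpa using isSemialgebraicFunOn_natCast hb 0
  have hβ : IsSemialgebraicFunOn ℚ {z : Fin 1 → ℝ | z 0 ∈ Set.Ioo ((0 : ℚ) : ℝ) ((1 : ℚ) : ℝ)}
      (fun z => (fun _ : ℝ => (1 : ℝ)) (z 0)) := by
    simpa using isSemialgebraicFunOn_natCast hb 1
  obtain ⟨r', hd, hi, hrel⟩ := h 0 1 (fun _ => 0) (fun _ => 1) (fun p => p 1) univ zeroSquare
    zero_lt_one hα hβ (fun t _ => zero_le_one) closedSquareSet_eq_band isSemialgebraicFunOn_snd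
    (fun t _ => continuousOn_id.congr fun s _ => by simp) isSemialgebraic_univ
    (fun p _ _ _ _ hZ => (hZ (mem_univ p)).elim)
  have hv : zeroSquare.value = r'.value := KZ.Equivalent.value_eq_holds hrel
  rw [value_zeroSquare, value_eq_of_const hd 1 fun z hz => by rw [hi z hz]; simp] at hv
  exact zero_ne_one hv

/-! ## (2) Fibrewise continuity of the primitive on the CLOSED fibre is load-bearing -/

/-- `stub_bandNewtonLeibniz` with the fibrewise-continuity hypothesis
`∀ t ∈ (a₀,a₁), ContinuousOn (fun s => F ![t, s]) (Icc (α t) (β t))` DELETED. -/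
def BandNLWithoutFibreContinuity : Prop := ∀ (a₀ a₁ : ℚ) (α β : ℝ → ℝ) (F : (Fin 2 → ℝ) → ℝ)
    (Z : Set (Fin 2 → ℝ)) (r : KZ.IntegralRep 2), a₀ < a₁ →
    IsSemialgebraicFunOn ℚ {z : Fin 1 → ℝ | z 0 ∈ Set.Ioo (a₀ : ℝ) a₁} (fun z => α (z 0)) →
    IsSemialgebraicFunOn ℚ {z : Fin 1 → ℝ | z 0 ∈ Set.Ioo (a₀ : ℝ) a₁} (fun z => β (z 0)) →
    (∀ t ∈ Set.Ioo (a₀ : ℝ) a₁, α t ≤ β t) →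
    r.domain = {p : Fin 2 → ℝ | p 0 ∈ Set.Icc (a₀ : ℝ) a₁ ∧ α (p 0) ≤ p 1 ∧ p 1 ≤ β (p 0)} →
    IsSemialgebraicFunOn ℚ r.domain F →
    IsSemialgebraic ℚ Z → volume Z = 0 →
    (∀ p ∈ r.domain, p 0 ∈ Set.Ioo (a₀ : ℝ) a₁ → α (p 0) < p 1 → p 1 < β (p 0) → p ∉ Z →
      HasDerivAt (fun s : ℝ => F ![p 0, s]) (r.integrand p) (p 1)) →
    ∃ r' : KZ.IntegralRep 1, r'.domain = {z : Fin 1 → ℝ | z 0 ∈ Set.Ioo (a₀ : ℝ) a₁} ∧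
      (∀ z ∈ r'.domain, r'.integrand z = F ![z 0, β (z 0)] - F ![z 0, α (z 0)]) ∧
      KZ.of r - KZ.of r' ∈ KZ.relations

/-- The jump primitive `F = 𝟙{y ≥ 1}` (as `if y < 1 then 0 else 1`). -/
def jumpF : (Fin 2 → ℝ) → ℝ := fun p => if p 1 < 1 then 0 else 1

/-- `jumpF` is `ℚ`-semialgebraic on the closed square (two constant pieces). -/
theorem isSemialgebraicFunOn_jumpF : IsSemialgebraicFunOn ℚ closedSquareSet jumpF := by
  have hlt : IsSemialgebraic ℚ {x : Fin 2 → ℝ | x 1 < 1} := by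
    simpa using isSemialgebraic_setOf_eval_lt (k := ℚ) (R := ℝ) (ι := Fin 2) (X 1) (C 1)
  have hge : IsSemialgebraic ℚ {x : Fin 2 → ℝ | 1 ≤ x 1} := by
    simpa using isSemialgebraic_setOf_eval_le (k := ℚ) (R := ℝ) (ι := Fin 2) (C 1) (X 1)
  have h0 : IsSemialgebraicFunOn ℚ (closedSquareSet ∩ {x : Fin 2 → ℝ | x 1 < 1}) (fun _ => (0 : ℝ)) := by
    simpa using isSemialgebraicFunOn_natCast (isSemialgebraic_closedSquareSet.inter hlt) 0
  have h1 : IsSemialgebraicFunOn ℚ (closedSquareSet ∩ {x : Fin 2 → ℝ | 1 ≤ x 1}) (fun _ => (1 : ℝ)) := by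
    simpa using isSemialgebraicFunOn_natCast (isSemialgebraic_closedSquareSet.inter hge) 1
  have hU : closedSquareSet ∩ {x : Fin 2 → ℝ | x 1 < 1} ∪ closedSquareSet ∩ {x : Fin 2 → ℝ | 1 ≤ x 1} =
      closedSquareSet := by
    rw [← inter_union_distrib_left]
    refine inter_eq_left.mpr fun x _ => ?_
    simp only [mem_union, mem_setOf_eq]
    exact lt_or_ge (x 1) 1
  rw [← hU]
  refine h0.union h1 (fun x hx => ?_) (fun x hx => ?_)
  · have : x 1 < 1 := hx.2
    simp [jumpF, this]
  · have : ¬ x 1 < 1 := not_lt.mpr hx.2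
    simp [jumpF, this]

/-- **Fibrewise continuity of `F` on the closed fibre is load-bearing in `stub_bandNewtonLeibniz`.**
Without it take the closed unit square with integrand `0`, `Z = ∅`, and the jump primitive
`F = 𝟙{y ≥ 1}`: on every open fibre `F(t,·)` is locally constant, so `∂F/∂y = 0` is the
integrand, but `F(t,1) − F(t,0) = 1`; the stub would give `[(0,1), 1] ≡ [[0,1]², 0]`, i.e. `1 = 0`. -/
theorem not_bandNLWithoutFibreContinuity : ¬ BandNLWithoutFibreContinuity := by
  intro h
  have hb : IsSemialgebraic ℚ {z : Fin 1 → ℝ | z 0 ∈ Set.Ioo ((0 : ℚ) : ℝ) ((1 : ℚ) : ℝ)} :=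
    isSemialgebraic_baseSet
  have hα : IsSemialgebraicFunOn ℚ {z : Fin 1 → ℝ | z 0 ∈ Set.Ioo ((0 : ℚ) : ℝ) ((1 : ℚ) : ℝ)}
      (fun z => (fun _ : ℝ => (0 : ℝ)) (z 0)) := by
    simpa using isSemialgebraicFunOn_natCast hb 0
  have hβ : IsSemialgebraicFunOn ℚ {z : Fin 1 → ℝ | z 0 ∈ Set.Ioo ((0 : ℚ) : ℝ) ((1 : ℚ) : ℝ)}
      (fun z => (fun _ : ℝ => (1 : ℝ)) (z 0)) := by
    simpa using isSemialgebraicFunOn_natCast hb 1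
  have hder : ∀ p ∈ zeroSquare.domain, p 0 ∈ Set.Ioo (((0 : ℚ)) : ℝ) ((1 : ℚ) : ℝ) →
      (fun _ : ℝ => (0 : ℝ)) (p 0) < p 1 → p 1 < (fun _ : ℝ => (1 : ℝ)) (p 0) → p ∉ (∅ : Set (Fin 2 → ℝ)) →
      HasDerivAt (fun s : ℝ => jumpF ![p 0, s]) (zeroSquare.integrand p) (p 1) := by
    intro p _ _ _ hp1 _
    have hp1' : p 1 < 1 := hp1
    refine (hasDerivAt_const (p 1) (0 : ℝ)).congr_of_eventuallyEq ?_
    filter_upwards [Iio_mem_nhds hp1'] with s hs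
    have hs' : s < 1 := hs
    simp [jumpF, hs']
  obtain ⟨r', hd, hi, hrel⟩ := h 0 1 (fun _ => 0) (fun _ => 1) jumpF ∅ zeroSquare
    zero_lt_one hα hβ (fun t _ => zero_le_one) closedSquareSet_eq_band isSemialgebraicFunOn_jumpF
    isSemialgebraic_empty measure_empty hder
  have hv : zeroSquare.value = r'.value := KZ.Equivalent.value_eq_holds hrel
  rw [value_zeroSquare, value_eq_of_const hd 1 fun z hz => by rw [hi z hz]; simp [jumpF]] at hv
  exact zero_ne_one hv

/-! ## (3) `α ≤ β` on the base is load-bearing -/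

/-- `stub_bandNewtonLeibniz` with the hypothesis `∀ t ∈ (a₀,a₁), α t ≤ β t` DELETED. -/
def BandNLWithoutLE : Prop := ∀ (a₀ a₁ : ℚ) (α β : ℝ → ℝ) (F : (Fin 2 → ℝ) → ℝ)
    (Z : Set (Fin 2 → ℝ)) (r : KZ.IntegralRep 2), a₀ < a₁ →
    IsSemialgebraicFunOn ℚ {z : Fin 1 → ℝ | z 0 ∈ Set.Ioo (a₀ : ℝ) a₁} (fun z => α (z 0)) →
    IsSemialgebraicFunOn ℚ {z : Fin 1 → ℝ | z 0 ∈ Set.Ioo (a₀ : ℝ) a₁} (fun z => β (z 0)) →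
    r.domain = {p : Fin 2 → ℝ | p 0 ∈ Set.Icc (a₀ : ℝ) a₁ ∧ α (p 0) ≤ p 1 ∧ p 1 ≤ β (p 0)} →
    IsSemialgebraicFunOn ℚ r.domain F →
    (∀ t ∈ Set.Ioo (a₀ : ℝ) a₁, ContinuousOn (fun s : ℝ => F ![t, s]) (Set.Icc (α t) (β t))) →
    IsSemialgebraic ℚ Z → volume Z = 0 →
    (∀ p ∈ r.domain, p 0 ∈ Set.Ioo (a₀ : ℝ) a₁ → α (p 0) < p 1 → p 1 < β (p 0) → p ∉ Z →
      HasDerivAt (fun s : ℝ => F ![p 0, s]) (r.integrand p) (p 1)) →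
    ∃ r' : KZ.IntegralRep 1, r'.domain = {z : Fin 1 → ℝ | z 0 ∈ Set.Ioo (a₀ : ℝ) a₁} ∧
      (∀ z ∈ r'.domain, r'.integrand z = F ![z 0, β (z 0)] - F ![z 0, α (z 0)]) ∧
      KZ.of r - KZ.of r' ∈ KZ.relations

/-- The empty band over `[0,1]` between `α = 1` and `β = 0`, in the stub's literal shape, is the
domain of the empty representation. -/
theorem empty_domain_eq_band : (KZ.IntegralRep.empty 2).domain =
    {p : Fin 2 → ℝ | p 0 ∈ Set.Icc ((0 : ℚ) : ℝ) ((1 : ℚ) : ℝ) ∧ (1 : ℝ) ≤ p 1 ∧ p 1 ≤ 0} := by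
  rw [KZ.IntegralRep.domain_empty]
  ext p
  simp only [mem_empty_iff_false, mem_setOf_eq, false_iff, not_and, not_le]
  intro _ h1
  linarith

/-- **`α ≤ β` is load-bearing in `stub_bandNewtonLeibniz`** (the reading fixed in `KZCalculus.lean`):
with `α = 1 > 0 = β` the band is EMPTY (value `0`) while the base integrand
`F(t, β t) − F(t, α t) = −1` for `F = y`; the stub would give `[(0,1), −1] ≡ [∅]`, i.e. `0 = −1`. -/
theorem not_bandNLWithoutLE : ¬ BandNLWithoutLE := by
  intro h
  have hb : IsSemialgebraic ℚ {z : Fin 1 → ℝ | z 0 ∈ Set.Ioo ((0 : ℚ) : ℝ) ((1 : ℚ) : ℝ)} :=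
    isSemialgebraic_baseSet
  have hα : IsSemialgebraicFunOn ℚ {z : Fin 1 → ℝ | z 0 ∈ Set.Ioo ((0 : ℚ) : ℝ) ((1 : ℚ) : ℝ)}
      (fun z => (fun _ : ℝ => (1 : ℝ)) (z 0)) := by
    simpa using isSemialgebraicFunOn_natCast hb 1
  have hβ : IsSemialgebraicFunOn ℚ {z : Fin 1 → ℝ | z 0 ∈ Set.Ioo ((0 : ℚ) : ℝ) ((1 : ℚ) : ℝ)}
      (fun z => (fun _ : ℝ => (0 : ℝ)) (z 0)) := by
    simpa using isSemialgebraicFunOn_natCast hb 0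
  have hF : IsSemialgebraicFunOn ℚ (KZ.IntegralRep.empty 2).domain (fun p : Fin 2 → ℝ => p 1) := by
    rw [KZ.IntegralRep.domain_empty]
    exact isSemialgebraicFunOn_apply isSemialgebraic_empty 1
  obtain ⟨r', hd, hi, hrel⟩ := h 0 1 (fun _ => 1) (fun _ => 0) (fun p => p 1) ∅ (KZ.IntegralRep.empty 2)
    zero_lt_one hα hβ empty_domain_eq_band hF (fun t _ => continuousOn_id.congr fun s _ => by simp)
    isSemialgebraic_empty measure_empty (fun p hp => (notMem_empty p hp).elim)
  have hv : (KZ.IntegralRep.empty 2).value = r'.value := KZ.Equivalent.value_eq_holds hrel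
  rw [KZ.IntegralRep.value_empty, value_eq_of_const hd (-1) fun z hz => by rw [hi z hz]; simp] at hv
  norm_num at hv

end Summit.KontsevichZagierPeriods.PlanarAreas.Negative.GreenBands

end
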